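import Summits.HodgeConjecture.CorCM.Census.QuarticInversionModel

/-!
# The quartic inversion twists, II: marginals, the Hodge lattice, pairs; the three motions preserve the Hodge lattice

COR-CM (cell `pub-hodgecm2`, stage 2 of the Hodge ladder), count-neutral KERNEL COMBINATORICS by the binder seat b23 (gen 44; claim
QUARTIC-INVERSION, HOME/INBOX.md l.12829).  Part II of the lane `Census/QuarticInversion*`, on top of part I (`…Model`: labels `Ty₄ B = Ty₂ B × Ty₂ B`,
motions `twH₄`, `twY ζ`, `twT`, translates) and of the dicyclic lane's part I (`Census/DicyclicTwistModel.lean`: `marg₀`, `marg₁`, `hodge₂`, `pairVec₂`,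
`conj`, `revT`, `translH`) and seat b09's slice (`Census/OddSliceFacesModel.lean`: `hodge`, `transl`), all BY NAME.  Bookkeeping definitions with bodies +
theorems; no `decide` table, no certificate, no named fact, no geometry, no `sorry`.  `Interfaces.lean` (C1), every E term, B01, `Transposition/*`,
`PortJoin/*` untouched.  HONEST FRAMING: `HC_CM` is NOT proved, here or anywhere in the tree; nothing here is a period, a count of record or a headline.

CONTENT (`G_ζ(B) ⊃ M ⊃ H₀ = ℤ/2 × B`, types of `(G_ζ(B), c)` = quadruples `Θ = (Ψ, Ψ') ∈ Ty₂ B × Ty₂ B`, part I).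
* §1 **The two pair-marginals** `Marg₀ v (Ψ) = Σ_{Ψ'} v(Ψ, Ψ')`, `Marg₁ v (Ψ') = Σ_{Ψ} v(Ψ, Ψ')` (the marginals of the index-two descent `G ⊃ M`,
  `Census/IndexTwoDescentHodge.lean`, read in the model) and their values on unit vectors and translates of unit vectors.
* §2 **The Hodge lattice** `hodge₄ = {v | Marg₀ v, Marg₁ v ∈ hodge₂}` — by `IndexTwoDescentHodge.mem_hodgeSpan_iff_marg` applied to `G ⊃ M` and then to
  `M ⊃ H₀` (the dicyclic lane's `hodge₂ = {w | marg₀ w, marg₁ w ∈ hodge}`), a vector is Hodge iff all four of its slice marginals are b09's Hodge vectors —,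
  the conjugate (divisor) pairs `e_Θ + e_{Θ̄}` (`Θ̄ = twH₄ c Θ`, all four coordinates conjugated) and `pairs₄ ≤ hodge₄`.
* §3 **The three motions preserve `hodge₄`** (`translH₄_mem`, `translY_mem`, `translT_mem`): the pair-marginals of a translate are relabelled
  pair-marginals (`Marg₀_translH₄`, …, `Marg₀_translT v = (Marg₁ v)(ψ₀, ψ₁ + 1)`, `Marg₁_translT v = (Marg₀ v)(ψ₀ + 1, ψ₁)`), and `hodge₂` is stable
  under the swap-twist of either square class (`translX'_mem`, both `ζ`) and under the two half-conjugations (`halfConj₀_mem`, `halfConj₁_mem`).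
All [folklore] (Pohlmann's dictionary [Pohlmann1968, Thm 1]).

## References
* [Pohlmann1968] H. Pohlmann, Algebraic cycles on abelian varieties of complex multiplication type, Ann. of Math. 88 (1968), Thm 1.
* [Milne1999] J. S. Milne, Lefschetz motives and the Tate conjecture, Compositio Math. 117 (1999), Prop. 2.1, p. 54.
-/

namespace Summit.HodgeConjecture.CorCM.Census.QuarticInversion

open Finset
open Summit.HodgeConjecture.CorCM.Census.OddSliceFacesModel
open Summit.HodgeConjecture.CorCM.Census.DicyclicTwist (Ty₂ rev rev_rev rev_add_one rev_add twH twH_twH twH_zero twH_one_zero twHEquiv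
  marg₀ marg₁ marg₀_apply marg₁_apply hodge₂ mem_hodge₂_iff conj pairVec₂ pairVec₂_mem revT revEquiv revT_mem_hodge translH translH_mem
  marg₀_translH marg₁_translH)

noncomputable section

variable (A : Type) [AddCommGroup A] [Fintype A] [DecidableEq A]

/-! ## §1 The pair-marginals -/

/-- **The `0`-pair-marginal** `(Marg₀ v)(Ψ) = Σ_{Ψ'} v(Ψ, Ψ')` (restriction to the subgroup `M` of index two). [folklore] -/
def Marg₀ : (Ty₄ A → ℤ) →ₗ[ℤ] (Ty₂ A → ℤ) where
  toFun v := fun Ψ => ∑ Ψ' : Ty₂ A, v (Ψ, Ψ')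
  map_add' v w := by funext Ψ; simp [Finset.sum_add_distrib]
  map_smul' n v := by funext Ψ; simp [Finset.mul_sum]

/-- **The `1`-pair-marginal** `(Marg₁ v)(Ψ') = Σ_{Ψ} v(Ψ, Ψ')` (the coset `tM`, pulled back along `t`). [folklore] -/
def Marg₁ : (Ty₄ A → ℤ) →ₗ[ℤ] (Ty₂ A → ℤ) where
  toFun v := fun Ψ' => ∑ Ψ : Ty₂ A, v (Ψ, Ψ')
  map_add' v w := by funext Ψ'; simp [Finset.sum_add_distrib]
  map_smul' n v := by funext Ψ'; simp [Finset.mul_sum]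

omit [AddCommGroup A] in
/-- `Marg₀` pointwise. [folklore] -/
theorem Marg₀_apply (v : Ty₄ A → ℤ) (Ψ : Ty₂ A) : Marg₀ A v Ψ = ∑ Ψ' : Ty₂ A, v (Ψ, Ψ') := rfl

omit [AddCommGroup A] in
/-- `Marg₁` pointwise. [folklore] -/
theorem Marg₁_apply (v : Ty₄ A → ℤ) (Ψ' : Ty₂ A) : Marg₁ A v Ψ' = ∑ Ψ : Ty₂ A, v (Ψ, Ψ') := rfl

omit [AddCommGroup A] in
/-- `Marg₀ (n·e_Θ) = n·e_{Θ.1}`. [folklore] -/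
@[simp] theorem Marg₀_single (Θ : Ty₄ A) (n : ℤ) : Marg₀ A (Pi.single Θ n) = Pi.single Θ.1 n := by
  obtain ⟨α, β⟩ := Θ
  funext Ψ
  rw [Marg₀_apply, Pi.single_apply]
  by_cases h : Ψ = α
  · subst h
    rw [if_pos rfl, Finset.sum_eq_single β]
    · simp
    · intro Ψ' _ hne
      simp [hne]
    · intro hβ; exact absurd (Finset.mem_univ β) hβ
  · rw [if_neg h]
    refine Finset.sum_eq_zero fun Ψ' _ => ?_
    have hne : (Ψ, Ψ') ≠ (α, β) := fun e => h (Prod.mk.inj e).1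
    simp [hne]

omit [AddCommGroup A] in
/-- `Marg₁ (n·e_Θ) = n·e_{Θ.2}`. [folklore] -/
@[simp] theorem Marg₁_single (Θ : Ty₄ A) (n : ℤ) : Marg₁ A (Pi.single Θ n) = Pi.single Θ.2 n := by
  obtain ⟨α, β⟩ := Θ
  funext Ψ'
  rw [Marg₁_apply, Pi.single_apply]
  by_cases h : Ψ' = β
  · subst h
    rw [if_pos rfl, Finset.sum_eq_single α]
    · simp
    · intro Ψ _ hne
      simp [hne]
    · intro hα; exact absurd (Finset.mem_univ α) hα
  · rw [if_neg h]
    refine Finset.sum_eq_zero fun Ψ _ => ?_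
    have hne : (Ψ, Ψ') ≠ (α, β) := fun e => h (Prod.mk.inj e).2
    simp [hne]

omit [DecidableEq A] in
/-- Translate of a unit vector by `h ∈ H₀`. [folklore] -/
theorem translH₄_single (g : ZMod 2 × A) (Θ : Ty₄ A) (n : ℤ) :
    translH₄ A g (Pi.single Θ n) = Pi.single (twH₄ A g Θ) n := by
  funext Φ
  have hiff : twH₄ A (-g) Φ = Θ ↔ Φ = twH₄ A g Θ := by
    constructor
    · intro h; rw [← h, twH₄_twH₄, neg_add_cancel, twH₄_zero]
    · intro h; rw [h, twH₄_twH₄, add_neg_cancel, twH₄_zero]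
  simp only [translH₄, Pi.single_apply, hiff]

omit [DecidableEq A] in
/-- Translate of a unit vector by `y`. [folklore] -/
theorem translY_single (ζ : ZMod 2) (Θ : Ty₄ A) (n : ℤ) :
    translY A ζ (Pi.single Θ n) = Pi.single (twY A ζ Θ) n := by
  funext Φ
  have hiff : twYinv A ζ Φ = Θ ↔ Φ = twY A ζ Θ := by
    constructor
    · intro h; rw [← h, twY_twYinv]
    · intro h; rw [h, twYinv_twY]
  simp only [translY, Pi.single_apply, hiff]

omit [AddCommGroup A] [DecidableEq A] in
/-- Translate of a unit vector by `t`. [folklore] -/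
theorem translT_single (Θ : Ty₄ A) (n : ℤ) :
    translT A (Pi.single Θ n) = Pi.single (twT A Θ) n := by
  funext Φ
  have hiff : twTinv A Φ = Θ ↔ Φ = twT A Θ := by
    constructor
    · intro h; rw [← h, twT_twTinv]
    · intro h; rw [h, twTinv_twT]
  simp only [translT, Pi.single_apply, hiff]

/-! ## §2 The Hodge lattice and the pairs -/

/-- **The Hodge lattice of `(G_ζ(B), c)`**: exponent vectors both of whose pair-marginals are Hodge vectors of the index-two subgroup `M`
(`Census/IndexTwoDescentHodge.mem_hodgeSpan_iff_marg` in the model, twice). [cite: Pohlmann1968, Thm 1] -/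
def hodge₄ : Submodule ℤ (Ty₄ A → ℤ) := (hodge₂ A).comap (Marg₀ A) ⊓ (hodge₂ A).comap (Marg₁ A)

omit [AddCommGroup A] in
/-- Membership in `hodge₄`. [folklore] -/
theorem mem_hodge₄_iff (v : Ty₄ A → ℤ) : v ∈ hodge₄ A ↔ Marg₀ A v ∈ hodge₂ A ∧ Marg₁ A v ∈ hodge₂ A := Iff.rfl

/-- Conjugation of a quadruple: all four coordinates conjugated (`= twH₄ c Θ`). [folklore] -/
def conj₄ (Θ : Ty₄ A) : Ty₄ A := (conj A Θ.1, conj A Θ.2)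

omit [Fintype A] [DecidableEq A] in
/-- Conjugation is the diagonal motion by `c = (1, 0)`. [folklore] -/
theorem conj₄_eq_twH₄ (Θ : Ty₄ A) : conj₄ A Θ = twH₄ A (1, 0) Θ := by
  rw [twH₄_one_zero]; rfl

/-- The conjugate (divisor) pair through `Θ`: `e_Θ + e_{Θ̄}`. [folklore] -/
def pairVec₄ (Θ : Ty₄ A) : Ty₄ A → ℤ := Pi.single Θ 1 + Pi.single (conj₄ A Θ) 1

/-- The divisor sublattice `P₄ = ℤ⟨pairs⟩`. [folklore] -/
def pairs₄ : Submodule ℤ (Ty₄ A → ℤ) := Submodule.span ℤ (Set.range (pairVec₄ A))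

omit [AddCommGroup A] in
/-- The `0`-pair-marginal of a pair is a pair of `M`. [folklore] -/
theorem Marg₀_pairVec₄ (Θ : Ty₄ A) : Marg₀ A (pairVec₄ A Θ) = pairVec₂ A Θ.1 := by
  rw [pairVec₄, map_add, Marg₀_single, Marg₀_single]; rfl

omit [AddCommGroup A] in
/-- The `1`-pair-marginal of a pair is a pair of `M`. [folklore] -/
theorem Marg₁_pairVec₄ (Θ : Ty₄ A) : Marg₁ A (pairVec₄ A Θ) = pairVec₂ A Θ.2 := by
  rw [pairVec₄, map_add, Marg₁_single, Marg₁_single]; rfl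

omit [AddCommGroup A] in
/-- **The pairs are Hodge vectors.** [folklore] -/
theorem pairVec₄_mem (Θ : Ty₄ A) : pairVec₄ A Θ ∈ hodge₄ A := by
  rw [mem_hodge₄_iff, Marg₀_pairVec₄, Marg₁_pairVec₄]
  exact ⟨pairVec₂_mem A _, pairVec₂_mem A _⟩

omit [AddCommGroup A] in
/-- `P₄ ≤ H₄`. [folklore] -/
theorem pairs₄_le_hodge₄ : pairs₄ A ≤ hodge₄ A := by
  refine Submodule.span_le.mpr ?_
  rintro _ ⟨Θ, rfl⟩
  exact pairVec₄_mem A Θ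

/-! ## §3 The three motions preserve the Hodge lattice -/

/-- The swap-twist of square class `ζ` as a permutation of the pairs of labels. [folklore] -/
def twX'Equiv (ζ : ZMod 2) : Ty₂ A ≃ Ty₂ A where
  toFun := twX' A ζ
  invFun := twX'inv A ζ
  left_inv := twX'inv_twX' A ζ
  right_inv := twX'_twX'inv A ζ

/-- Transport of an `M`-vector along the swap-twist of square class `ζ`: `(translX' ζ w)(Ψ) = w (twX'inv ζ Ψ)`. [folklore] -/
def translX' (ζ : ZMod 2) (w : Ty₂ A → ℤ) : Ty₂ A → ℤ := fun Ψ => w (twX'inv A ζ Ψ)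

/-- Shift of a slice vector by the constant `ζ`: `(shiftC ζ u)(ψ) = u (ψ + cst ζ)`. [folklore] -/
def shiftC (ζ : ZMod 2) (u : Ty A → ℤ) : Ty A → ℤ := fun ψ => u (ψ + cst A ζ)

omit [Fintype A] [DecidableEq A] in
/-- `−(ζ, 0) = (ζ, 0)` in `ℤ/2 × B`. [folklore] -/
theorem neg_cst_zero (ζ : ZMod 2) : -((ζ, (0 : A)) : ZMod 2 × A) = (ζ, 0) := by
  have key : ∀ u : ZMod 2, -u = u := by decide
  ext <;> simp [key]

omit [Fintype A] [DecidableEq A] in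
/-- The constant shift is b09's translation by `(ζ, 0)`. [folklore] -/
theorem shiftC_eq_transl (ζ : ZMod 2) (u : Ty A → ℤ) : shiftC A ζ u = transl A (ζ, 0) u := by
  funext ψ
  simp only [shiftC, transl, neg_cst_zero, tw_cst_zero]

/-- The constant shift preserves b09's Hodge lattice. [folklore] -/
theorem shiftC_mem {u : Ty A → ℤ} (hu : u ∈ hodge A) (ζ : ZMod 2) : shiftC A ζ u ∈ hodge A := by
  rw [shiftC_eq_transl]; exact transl_mem A hu _

/-- **The `0`-marginal of the swap-twisted vector is the reversed `1`-marginal.** [folklore] -/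
theorem marg₀_translX' (ζ : ZMod 2) (w : Ty₂ A → ℤ) : marg₀ A (translX' A ζ w) = revT A (marg₁ A w) := by
  funext α
  rw [marg₀_apply]
  show ∑ β : Ty A, w (twX'inv A ζ (α, β)) = ∑ ψ₀ : Ty A, w (ψ₀, rev A α)
  simp only [twX'inv]
  exact Fintype.sum_equiv ((revEquiv A).trans (Equiv.addRight (cst A ζ))) _ _ fun β => rfl

/-- **The `1`-marginal of the swap-twisted vector is the reversed, `ζ`-shifted `0`-marginal.** [folklore] -/
theorem marg₁_translX' (ζ : ZMod 2) (w : Ty₂ A → ℤ) : marg₁ A (translX' A ζ w) = revT A (shiftC A ζ (marg₀ A w)) := by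
  funext β
  rw [marg₁_apply]
  show ∑ α : Ty A, w (twX'inv A ζ (α, β)) = ∑ ψ₁ : Ty A, w (rev A β + cst A ζ, ψ₁)
  simp only [twX'inv]
  exact Fintype.sum_equiv (revEquiv A) _ _ fun α => rfl

/-- **`hodge₂` is stable under the swap-twist of either square class.** [folklore] -/
theorem translX'_mem (ζ : ZMod 2) {w : Ty₂ A → ℤ} (hw : w ∈ hodge₂ A) : translX' A ζ w ∈ hodge₂ A := by
  rw [mem_hodge₂_iff] at hw ⊢
  rw [marg₀_translX', marg₁_translX']
  exact ⟨revT_mem_hodge A hw.2, revT_mem_hodge A (shiftC_mem A hw.1 ζ)⟩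

/-- Half-conjugation in the first coordinate of a pair: `w ↦ w(ψ₀ + 1, ψ₁)`. [folklore] -/
def halfConj₀ (w : Ty₂ A → ℤ) : Ty₂ A → ℤ := fun Ψ => w (Ψ.1 + 1, Ψ.2)

/-- Half-conjugation in the second coordinate of a pair: `w ↦ w(ψ₀, ψ₁ + 1)`. [folklore] -/
def halfConj₁ (w : Ty₂ A → ℤ) : Ty₂ A → ℤ := fun Ψ => w (Ψ.1, Ψ.2 + 1)

omit [AddCommGroup A] in
/-- `marg₀` of a `0`-half-conjugate is the `1`-shifted `marg₀`. [folklore] -/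
theorem marg₀_halfConj₀ (w : Ty₂ A → ℤ) : marg₀ A (halfConj₀ A w) = shiftC A 1 (marg₀ A w) := by
  funext ψ₀; rfl

omit [AddCommGroup A] in
/-- `marg₁` of a `0`-half-conjugate is `marg₁`. [folklore] -/
theorem marg₁_halfConj₀ (w : Ty₂ A → ℤ) : marg₁ A (halfConj₀ A w) = marg₁ A w := by
  funext ψ₁
  rw [marg₁_apply, marg₁_apply]
  exact Fintype.sum_equiv (Equiv.addRight (1 : Ty A)) _ _ fun ψ₀ => rfl

omit [AddCommGroup A] in
/-- `marg₀` of a `1`-half-conjugate is `marg₀`. [folklore] -/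
theorem marg₀_halfConj₁ (w : Ty₂ A → ℤ) : marg₀ A (halfConj₁ A w) = marg₀ A w := by
  funext ψ₀
  rw [marg₀_apply, marg₀_apply]
  exact Fintype.sum_equiv (Equiv.addRight (1 : Ty A)) _ _ fun ψ₁ => rfl

omit [AddCommGroup A] in
/-- `marg₁` of a `1`-half-conjugate is the `1`-shifted `marg₁`. [folklore] -/
theorem marg₁_halfConj₁ (w : Ty₂ A → ℤ) : marg₁ A (halfConj₁ A w) = shiftC A 1 (marg₁ A w) := by
  funext ψ₁; rfl

/-- `hodge₂` is stable under `0`-half-conjugation. [folklore] -/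
theorem halfConj₀_mem {w : Ty₂ A → ℤ} (hw : w ∈ hodge₂ A) : halfConj₀ A w ∈ hodge₂ A := by
  rw [mem_hodge₂_iff] at hw ⊢
  rw [marg₀_halfConj₀, marg₁_halfConj₀]
  exact ⟨shiftC_mem A hw.1 1, hw.2⟩

/-- `hodge₂` is stable under `1`-half-conjugation. [folklore] -/
theorem halfConj₁_mem {w : Ty₂ A → ℤ} (hw : w ∈ hodge₂ A) : halfConj₁ A w ∈ hodge₂ A := by
  rw [mem_hodge₂_iff] at hw ⊢
  rw [marg₀_halfConj₁, marg₁_halfConj₁]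
  exact ⟨hw.1, shiftC_mem A hw.2 1⟩

/-- **`Marg₀` of an `h`-translate is the `h`-translate of `Marg₀`.** [folklore] -/
theorem Marg₀_translH₄ (g : ZMod 2 × A) (v : Ty₄ A → ℤ) : Marg₀ A (translH₄ A g v) = translH A g (Marg₀ A v) := by
  funext Ψ
  rw [Marg₀_apply]
  show ∑ Ψ' : Ty₂ A, v (twH₄ A (-g) (Ψ, Ψ')) = ∑ Ψ' : Ty₂ A, v (twH A (-g) Ψ, Ψ')
  exact Fintype.sum_equiv (twHEquiv A (-g)) _ _ fun Ψ' => rfl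

/-- **`Marg₁` of an `h`-translate is the `h`-translate of `Marg₁`.** [folklore] -/
theorem Marg₁_translH₄ (g : ZMod 2 × A) (v : Ty₄ A → ℤ) : Marg₁ A (translH₄ A g v) = translH A g (Marg₁ A v) := by
  funext Ψ'
  rw [Marg₁_apply]
  show ∑ Ψ : Ty₂ A, v (twH₄ A (-g) (Ψ, Ψ')) = ∑ Ψ : Ty₂ A, v (Ψ, twH A (-g) Ψ')
  exact Fintype.sum_equiv (twHEquiv A (-g)) _ _ fun Ψ => rfl

/-- **`Marg₀` of the `y`-translate is the swap-twisted `Marg₀`.** [folklore] -/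
theorem Marg₀_translY (ζ : ZMod 2) (v : Ty₄ A → ℤ) : Marg₀ A (translY A ζ v) = translX' A ζ (Marg₀ A v) := by
  funext Ψ
  rw [Marg₀_apply]
  show ∑ Ψ' : Ty₂ A, v (twYinv A ζ (Ψ, Ψ')) = ∑ Ψ' : Ty₂ A, v (twX'inv A ζ Ψ, Ψ')
  exact Fintype.sum_equiv (twX'Equiv A ζ).symm _ _ fun Ψ' => rfl

/-- **`Marg₁` of the `y`-translate is the swap-twisted `Marg₁`.** [folklore] -/
theorem Marg₁_translY (ζ : ZMod 2) (v : Ty₄ A → ℤ) : Marg₁ A (translY A ζ v) = translX' A ζ (Marg₁ A v) := by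
  funext Ψ'
  rw [Marg₁_apply]
  show ∑ Ψ : Ty₂ A, v (twYinv A ζ (Ψ, Ψ')) = ∑ Ψ : Ty₂ A, v (Ψ, twX'inv A ζ Ψ')
  exact Fintype.sum_equiv (twX'Equiv A ζ).symm _ _ fun Ψ => rfl

/-- The relabelling `(ψ₀, ψ₁) ↦ (ψ₀ + 1, ψ₁)` as a permutation. [folklore] -/
def halfConj₀Equiv : Ty₂ A ≃ Ty₂ A where
  toFun Ψ := (Ψ.1 + 1, Ψ.2)
  invFun Ψ := (Ψ.1 + 1, Ψ.2)
  left_inv Ψ := by obtain ⟨ψ₀, ψ₁⟩ := Ψ; simp only [add_one_add_one]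
  right_inv Ψ := by obtain ⟨ψ₀, ψ₁⟩ := Ψ; simp only [add_one_add_one]

/-- The relabelling `(ψ₀, ψ₁) ↦ (ψ₀, ψ₁ + 1)` as a permutation. [folklore] -/
def halfConj₁Equiv : Ty₂ A ≃ Ty₂ A where
  toFun Ψ := (Ψ.1, Ψ.2 + 1)
  invFun Ψ := (Ψ.1, Ψ.2 + 1)
  left_inv Ψ := by obtain ⟨ψ₀, ψ₁⟩ := Ψ; simp only [add_one_add_one]
  right_inv Ψ := by obtain ⟨ψ₀, ψ₁⟩ := Ψ; simp only [add_one_add_one]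

omit [AddCommGroup A] in
/-- **`Marg₀` of the `t`-translate is the `1`-half-conjugated `Marg₁`.** [folklore] -/
theorem Marg₀_translT (v : Ty₄ A → ℤ) : Marg₀ A (translT A v) = halfConj₁ A (Marg₁ A v) := by
  funext Ψ
  rw [Marg₀_apply]
  show ∑ Ψ' : Ty₂ A, v (twTinv A (Ψ, Ψ')) = ∑ Φ : Ty₂ A, v (Φ, (Ψ.1, Ψ.2 + 1))
  exact Fintype.sum_equiv (halfConj₀Equiv A) _ _ fun Ψ' => rfl

omit [AddCommGroup A] in
/-- **`Marg₁` of the `t`-translate is the `0`-half-conjugated `Marg₀`.** [folklore] -/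
theorem Marg₁_translT (v : Ty₄ A → ℤ) : Marg₁ A (translT A v) = halfConj₀ A (Marg₀ A v) := by
  funext Ψ'
  rw [Marg₁_apply]
  show ∑ Ψ : Ty₂ A, v (twTinv A (Ψ, Ψ')) = ∑ Φ : Ty₂ A, v ((Ψ'.1 + 1, Ψ'.2), Φ)
  exact Fintype.sum_equiv (halfConj₁Equiv A) _ _ fun Ψ => rfl

/-- **`H₄` is stable under the diagonal motions.** [folklore] -/
theorem translH₄_mem {v : Ty₄ A → ℤ} (hv : v ∈ hodge₄ A) (g : ZMod 2 × A) : translH₄ A g v ∈ hodge₄ A := by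
  rw [mem_hodge₄_iff] at hv ⊢
  rw [Marg₀_translH₄, Marg₁_translH₄]
  exact ⟨translH_mem A hv.1 g, translH_mem A hv.2 g⟩

/-- **`H₄` is stable under the motion of `y`.** [folklore] -/
theorem translY_mem (ζ : ZMod 2) {v : Ty₄ A → ℤ} (hv : v ∈ hodge₄ A) : translY A ζ v ∈ hodge₄ A := by
  rw [mem_hodge₄_iff] at hv ⊢
  rw [Marg₀_translY, Marg₁_translY]
  exact ⟨translX'_mem A ζ hv.1, translX'_mem A ζ hv.2⟩

/-- **`H₄` is stable under the motion of `t`.** [folklore] -/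
theorem translT_mem {v : Ty₄ A → ℤ} (hv : v ∈ hodge₄ A) : translT A v ∈ hodge₄ A := by
  rw [mem_hodge₄_iff] at hv ⊢
  rw [Marg₀_translT, Marg₁_translT]
  exact ⟨halfConj₁_mem A hv.2, halfConj₀_mem A hv.1⟩

omit [DecidableEq A] in
/-- **`P₄` is stable under the three motions** (a translate of a pair is a pair). [folklore] -/
theorem translH₄_pairVec₄ (g : ZMod 2 × A) (Θ : Ty₄ A) : translH₄ A g (pairVec₄ A Θ) = pairVec₄ A (twH₄ A g Θ) := by
  have h2 : twH₄ A g (conj₄ A Θ) = conj₄ A (twH₄ A g Θ) := by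
    rw [conj₄_eq_twH₄, conj₄_eq_twH₄, twH₄_twH₄, twH₄_twH₄, add_comm]
  show translH₄Hom A g (Pi.single Θ 1 + Pi.single (conj₄ A Θ) 1) =
    Pi.single (twH₄ A g Θ) 1 + Pi.single (conj₄ A (twH₄ A g Θ)) 1
  rw [map_add, translH₄Hom_apply, translH₄Hom_apply, translH₄_single, translH₄_single, h2]

omit [DecidableEq A] in
/-- A `y`-translate of a pair is a pair. [folklore] -/
theorem translY_pairVec₄ (ζ : ZMod 2) (Θ : Ty₄ A) : translY A ζ (pairVec₄ A Θ) = pairVec₄ A (twY A ζ Θ) := by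
  have h2 : twY A ζ (conj₄ A Θ) = conj₄ A (twY A ζ Θ) := by
    rw [conj₄_eq_twH₄, conj₄_eq_twH₄, twY_twH₄, neg_zero]
  show translYHom A ζ (Pi.single Θ 1 + Pi.single (conj₄ A Θ) 1) =
    Pi.single (twY A ζ Θ) 1 + Pi.single (conj₄ A (twY A ζ Θ)) 1
  rw [map_add, translYHom_apply, translYHom_apply, translY_single, translY_single, h2]

omit [DecidableEq A] in
/-- A `t`-translate of a pair is a pair. [folklore] -/
theorem translT_pairVec₄ (Θ : Ty₄ A) : translT A (pairVec₄ A Θ) = pairVec₄ A (twT A Θ) := by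
  have h2 : twT A (conj₄ A Θ) = conj₄ A (twT A Θ) := by
    rw [conj₄_eq_twH₄, conj₄_eq_twH₄, twT_twH₄]
  show translTHom A (Pi.single Θ 1 + Pi.single (conj₄ A Θ) 1) =
    Pi.single (twT A Θ) 1 + Pi.single (conj₄ A (twT A Θ)) 1
  rw [map_add, translTHom_apply, translTHom_apply, translT_single, translT_single, h2]

end

end Summit.HodgeConjecture.CorCM.Census.QuarticInversion
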